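import Summits.QuantumFields.YangMills.Theorems.FluctuationComparisonRegPrIntLOrganTangentTelescopeWindowPathMixed
import Summits.QuantumFields.YangMills.Theorems.FluctuationComparisonRegPrIntLOrganTangentGaugeConjugateProbe
import HarnessLib

/-!
# THE MIXED TELESCOPE ALONG TWO WINDOW PATHS WITH SHARED BONDS (def-free) — (T2′), the shared-bond edition of
# ✓`…OrganTangentTelescopeWindowPathMixed` (T2): the base path's moves are read through CONJUGATES by the top path's prefix

Cell `ym3-torus` (YM ladder rung R3 = continuum `SU(2)` Yang–Mills on the three-torus — a RUNG, NOT d = 4, NOT infinite volume, NOT a mass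
gap, NOT Clay).  Width seat `ym3-torus-px20` (gen 17), LEAD-20520 w3 g25 WORD №3 (T2) follow-up; `--supports stmt-QuantumFields-20520 --as helper`,
count-neutral, definition-free, default heartbeats; no registry, binder or `Lines/` edit (registered skeleton `Lines/semiclassical_s2beta.lean`
v11.4, 0∕5, untouched).

WHAT THIS IS.  (T2)'s double telescope needs every top move to commute with every base move (bond-DISJOINT paths); BRICK 2a's two
displacement paths OVERLAP (LEAD w3 g25 №3∕№4; w5 g22 FINDING §6).  At a shared bond the grid cell is STILL a clause square, with the base
move's parameter CONJUGATED by the top prefix's ordered product at that bond (`p·(update Y c (Y c * g)) = update (p·Y) c ((p·Y) c * (P_c⁻¹ g P_c))`);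
for `SU(2)`, `P⁻¹·expPt n·P = expPt (Ad_{P⁻¹} n)` (✓`conj_expPt`), `‖toE (Ad n)‖ = ‖toE n‖` (✓`norm_toE_adVec`), so sup-size `≤ √3·‖n‖`.
* §1 ABSTRACT, pointwise structure (same-index PUSH `φ`, distinct-index commutation, invariant class `Inv n ·` with `sz ≤ S n` on it):
  `exists_push`, ★`secondDiff_path_move_of_push_on`, ★★`secondDiff_path_path_of_push_on` (`≤ Σ_{(c,n) ∈ q} Σ_{(a,m) ∈ p} k c a·S n·sz m`),
  `sum_sum_mul_const`, ★★`secondDiff_path_path_of_push_on'` (= BRICK 2a's `hT2` SHAPE: base `P` first, top `Q` second, `C·ΣΣ k·sz·sz`).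
* §1b ABSTRACT, PATH-LEVEL conjugation hypothesis `hconj` (LEAD №4's shape; reverse induction on the top path): ★`secondDiff_move_path_of_conj_on`,
  ★★`secondDiff_path_path_of_conj_on` (BRICK 2a's `hT2` shape).
* §2 ORGAN (`update U b (U b * expPt v)`, `sz = ‖·‖∕θ`, `C = √3`, `φ h g = Ad_{(expPt h)⁻¹} g`, `Inv n n′ := ‖toE n′‖ = ‖toE n‖`): `move_push_same`,
  `exists_push_window_path`, ★★`secondDiff_window_paths` (top `p` ∕ base `q`, bound `Σ_q Σ_p k c a·(√3‖w‖∕θ)·(‖v‖∕θ)`) and ★★`secondDiff_window_paths'`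
  (BRICK 2a's `hT2` shape VERBATIM at `act := update-move, sz := ‖·‖∕θ, Good := PlaqSmall θ, ρ := r, C := √3` — docks by `exact`, kernel-checked).
Convention: `k (base bond) (top bond)·size(base)·size(top)`; the `√3`∕`C` sits on the BASE path (its parameters are the conjugated ones).

HONEST: [folklore] telescoping∕Lie bookkeeping over a HYPOTHESIS clause; nothing of Bałaban's is asserted or proved; LINᵘ-H, JENᵘ-H, O1ᵘ-H v2,
S3ᴴ, crux 20520, `YM3TorusSU2` NOT proved; no summit is proved by a telescope.  R3 = SU(2) YM₃ on T³ — NOT d = 4, NOT infinite volume, NOT a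
mass gap, NOT Clay; the Yang–Mills mass gap is NOT proved.  Sorry-free, axioms standard.
[cite: Balaban1985UV3, p.263 (c) and (41) p.266; Balaban1989LargeFieldI, (1.77) p.194; Balaban1985Variational, Thm 1 (9)-(10) p.279]
-/

set_option autoImplicit false

noncomputable section

open Function
open Literature.MathematicalPhysics.QuantumFieldTheory.Balaban1983to89
open T4CubeChartExp (toE expPt)
open B15Prop1ChartSU2 (adSU2)
open Summit.QuantumFields.YangMills.Theorems.OrganTangentTelescopeWindowPath (clause_update_of_HClauseSq)
open Summit.QuantumFields.YangMills.Theorems.OrganTangentTelescopeWindowPathMixed (abs_le_of_add_eq move_comm_of_ne)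
open Summit.QuantumFields.YangMills.Theorems.OrganTangentGaugeConjugateProbe (conj_expPt norm_toE_adVec norm_ofLp_le norm_toE_le)

namespace Summit.QuantumFields.YangMills.Theorems.OrganTangentTelescopeWindowPathShared

/-! ## §1 Abstract telescope with a same-index push -/
section Abstract

variable {X ι M : Type*}

/-- PUSH LEMMA: a base move `(c, n′)` UNDER a top path `p` = a move at `c` ON TOP of `p`, parameter transported inside the `Inv n`-class. [folklore] -/
theorem exists_push (act : X → ι → M → X) (φ : M → M → M) (Inv : M → M → Prop)
    (hpush : ∀ (U : X) (b : ι) (g h : M), act (act U b g) b h = act (act U b h) b (φ h g))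
    (hcomm : ∀ (U : X) (b c : ι) (g h : M), b ≠ c → act (act U b g) c h = act (act U c h) b g)
    (hInvφ : ∀ (n n' h : M), Inv n n' → Inv n (φ h n')) (c : ι) (n : M) :
    ∀ (p : List (ι × M)) (Y : X) (n' : M), Inv n n' →
      ∃ n'' : M, Inv n n'' ∧
        p.foldl (fun V s => act V s.1 s.2) (act Y c n') = act (p.foldl (fun V s => act V s.1 s.2) Y) c n'' := by
  intro p
  induction p with
  | nil => intro Y n' h; exact ⟨n', h, rfl⟩
  | cons a as ih =>
    intro Y n' h
    rw [List.foldl_cons, List.foldl_cons]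
    by_cases hac : a.1 = c
    · have hstep : act (act Y c n') a.1 a.2 = act (act Y a.1 a.2) c (φ a.2 n') := by
        rw [hac]; exact hpush Y c n' a.2
      rw [hstep]
      exact ih (act Y a.1 a.2) (φ a.2 n') (hInvφ n n' a.2 h)
    · have hstep : act (act Y c n') a.1 a.2 = act (act Y a.1 a.2) c n' := hcomm Y c a.1 n' a.2 (Ne.symm hac)
      rw [hstep]
      exact ih (act Y a.1 a.2) n' h

/-- ★ TOP PATH versus ONE BASE MOVE (windowed), shared indices allowed: `|f (p·(act U c n′)) − f (act U c n′) − f (p·U) + f U| ≤ Σ_{(a,m) ∈ p} k c a·S n·sz m`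
for every `n′` in the class of `n`; prefixes of `p` on `U` and on `act U c n′` `Good`, top sizes `≤ ρ`, `S n ≤ ρ`. [folklore] -/
theorem secondDiff_path_move_of_push_on (Good : X → Prop) (ρ : ℝ) (act : X → ι → M → X) (sz S : M → ℝ) (f : X → ℝ)
    (k : ι → ι → ℝ) (φ : M → M → M) (Inv : M → M → Prop)
    (hH : ∀ (U : X) (b b' : ι) (m m' : M), Good U → Good (act U b m) → Good (act U b' m') → Good (act (act U b m) b' m') →
      sz m ≤ ρ → sz m' ≤ ρ → |f (act (act U b m) b' m') - f (act U b m) - f (act U b' m') + f U| ≤ k b b' * sz m * sz m')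
    (hk : ∀ b b', 0 ≤ k b b') (hsz : ∀ m, 0 ≤ sz m)
    (hpush : ∀ (U : X) (b : ι) (g h : M), act (act U b g) b h = act (act U b h) b (φ h g))
    (hcomm : ∀ (U : X) (b c : ι) (g h : M), b ≠ c → act (act U b g) c h = act (act U c h) b g)
    (hInvφ : ∀ (n n' h : M), Inv n n' → Inv n (φ h n')) (hInvS : ∀ (n n' : M), Inv n n' → sz n' ≤ S n)
    (c : ι) (n : M) (hn : S n ≤ ρ) :
    ∀ (p : List (ι × M)) (U : X) (n' : M), Inv n n' →
      (∀ s ∈ p, sz s.2 ≤ ρ) →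
      (∀ i ≤ p.length, Good ((p.take i).foldl (fun V s => act V s.1 s.2) U) ∧
        Good ((p.take i).foldl (fun V s => act V s.1 s.2) (act U c n'))) →
      |f (p.foldl (fun V s => act V s.1 s.2) (act U c n')) - f (act U c n') - f (p.foldl (fun V s => act V s.1 s.2) U) + f U|
        ≤ (p.map (fun s => k c s.1 * S n * sz s.2)).sum := by
  intro p
  induction p with
  | nil =>
    intro U n' _ _ _
    have h0 : f (act U c n') - f (act U c n') - f U + f U = 0 := by ring
    simp only [List.foldl_nil, List.map_nil, List.sum_nil, h0, abs_zero, le_refl]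
  | cons a as ih =>
    intro U n' hInv hszp hgood
    obtain ⟨n'', hInv'', hca⟩ :=
      exists_push act φ Inv hpush hcomm hInvφ c n [a] U n' hInv
    simp only [List.foldl_cons, List.foldl_nil] at hca
    have hg0 := hgood 0 (Nat.zero_le _)
    have hg1 := hgood 1 (by simp)
    simp only [List.take_zero, List.foldl_nil] at hg0
    simp only [List.take_succ_cons, List.take_zero, List.foldl_cons, List.foldl_nil] at hg1
    have hn' : sz n' ≤ ρ := (hInvS n n' hInv).trans hn
    have h1 := hH U c a.1 n' a.2 hg0.1 hg0.2 hg1.1 hg1.2 hn' (hszp a (by simp))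
    have h1' : |f (act (act U c n') a.1 a.2) - f (act U c n') - f (act U a.1 a.2) + f U| ≤ k c a.1 * S n * sz a.2 :=
      h1.trans (mul_le_mul_of_nonneg_right (mul_le_mul_of_nonneg_left (hInvS n n' hInv) (hk c a.1)) (hsz a.2))
    rw [hca] at h1'
    have hgood' : ∀ i ≤ as.length, Good ((as.take i).foldl (fun V s => act V s.1 s.2) (act U a.1 a.2)) ∧
        Good ((as.take i).foldl (fun V s => act V s.1 s.2) (act (act U a.1 a.2) c n'')) := by
      intro i hi
      have := hgood (i + 1) (by simpa using hi)
      rw [← hca]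
      simpa [List.take_succ_cons, List.foldl_cons] using this
    have h2 := ih (act U a.1 a.2) n'' hInv'' (fun s hs => hszp s (List.mem_cons_of_mem a hs)) hgood'
    rw [List.foldl_cons, List.foldl_cons, hca]
    refine (abs_le_of_add_eq h2 h1' ?_).trans_eq ?_
    · ring
    · simp only [List.map_cons, List.sum_cons]; ring

/-- ★★ THE DOUBLE TELESCOPE WITH SHARED INDICES (windowed): top `p`, base `q`, every grid configuration `(p.take i)·((q.take j)·U)` `Good`, top sizes
`sz ≤ ρ`, base majorants `S ≤ ρ`: `|f (p·(q·U)) − f (q·U) − f (p·U) + f U| ≤ Σ_{(c,n) ∈ q} Σ_{(a,m) ∈ p} k c a·S n·sz m`. [folklore] -/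
theorem secondDiff_path_path_of_push_on (Good : X → Prop) (ρ : ℝ) (act : X → ι → M → X) (sz S : M → ℝ) (f : X → ℝ)
    (k : ι → ι → ℝ) (φ : M → M → M) (Inv : M → M → Prop)
    (hH : ∀ (U : X) (b b' : ι) (m m' : M), Good U → Good (act U b m) → Good (act U b' m') → Good (act (act U b m) b' m') →
      sz m ≤ ρ → sz m' ≤ ρ → |f (act (act U b m) b' m') - f (act U b m) - f (act U b' m') + f U| ≤ k b b' * sz m * sz m')
    (hk : ∀ b b', 0 ≤ k b b') (hsz : ∀ m, 0 ≤ sz m)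
    (hpush : ∀ (U : X) (b : ι) (g h : M), act (act U b g) b h = act (act U b h) b (φ h g))
    (hcomm : ∀ (U : X) (b c : ι) (g h : M), b ≠ c → act (act U b g) c h = act (act U c h) b g)
    (hInv0 : ∀ n : M, Inv n n) (hInvφ : ∀ (n n' h : M), Inv n n' → Inv n (φ h n'))
    (hInvS : ∀ (n n' : M), Inv n n' → sz n' ≤ S n)
    (p : List (ι × M)) (hszp : ∀ s ∈ p, sz s.2 ≤ ρ) :
    ∀ (q : List (ι × M)) (U : X),
      (∀ t ∈ q, S t.2 ≤ ρ) →
      (∀ i ≤ p.length, ∀ j ≤ q.length,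
        Good ((p.take i).foldl (fun V s => act V s.1 s.2) ((q.take j).foldl (fun V s => act V s.1 s.2) U))) →
      |f (p.foldl (fun V s => act V s.1 s.2) (q.foldl (fun V s => act V s.1 s.2) U)) - f (q.foldl (fun V s => act V s.1 s.2) U)
        - f (p.foldl (fun V s => act V s.1 s.2) U) + f U|
        ≤ (q.map (fun t => (p.map (fun s => k t.1 s.1 * S t.2 * sz s.2)).sum)).sum := by
  intro q
  induction q with
  | nil =>
    intro U _ _
    have h0 : f (p.foldl (fun V s => act V s.1 s.2) U) - f U - f (p.foldl (fun V s => act V s.1 s.2) U) + f U = 0 := by ring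
    simp only [List.foldl_nil, List.map_nil, List.sum_nil, h0, abs_zero, le_refl]
  | cons c cs ih =>
    intro U hSq hgood
    have hgood0 : ∀ i ≤ p.length, Good ((p.take i).foldl (fun V s => act V s.1 s.2) U) ∧
        Good ((p.take i).foldl (fun V s => act V s.1 s.2) (act U c.1 c.2)) := by
      intro i hi
      refine ⟨?_, ?_⟩
      · have := hgood i hi 0 (Nat.zero_le _)
        simpa [List.take_zero, List.foldl_nil] using this
      · have := hgood i hi 1 (by simp)
        simpa [List.take_succ_cons, List.take_zero, List.foldl_cons, List.foldl_nil] using this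
    have h1 := secondDiff_path_move_of_push_on Good ρ act sz S f k φ Inv hH hk hsz hpush hcomm hInvφ hInvS c.1 c.2
      (hSq c (by simp)) p U c.2 (hInv0 c.2) hszp hgood0
    have hgood' : ∀ i ≤ p.length, ∀ j ≤ cs.length,
        Good ((p.take i).foldl (fun V s => act V s.1 s.2) ((cs.take j).foldl (fun V s => act V s.1 s.2) (act U c.1 c.2))) := by
      intro i hi j hj
      have := hgood i hi (j + 1) (by simpa using hj)
      simpa [List.take_succ_cons, List.foldl_cons] using this
    have h2 := ih (act U c.1 c.2) (fun t ht => hSq t (List.mem_cons_of_mem c ht)) hgood'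
    rw [List.foldl_cons]
    refine (abs_le_of_add_eq h2 h1 ?_).trans_eq ?_
    · ring
    · simp only [List.map_cons, List.sum_cons, add_comm]

/-- Pulling a constant majorant factor out of the double path sum. [folklore] -/
theorem sum_sum_mul_const (k : ι → ι → ℝ) (sz : M → ℝ) (C : ℝ) (Q : List (ι × M)) :
    ∀ (P : List (ι × M)), (P.map (fun a => (Q.map (fun c => k a.1 c.1 * (C * sz a.2) * sz c.2)).sum)).sum
      = C * (P.map (fun a => (Q.map (fun c => k a.1 c.1 * sz a.2 * sz c.2)).sum)).sum := by
  intro P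
  induction P with
  | nil => simp
  | cons a as ih =>
    have hfun : (fun c : ι × M => k a.1 c.1 * (C * sz a.2) * sz c.2) = fun c => C * (k a.1 c.1 * sz a.2 * sz c.2) := by
      funext c; ring
    rw [List.map_cons, List.sum_cons, List.map_cons, List.sum_cons, ih, hfun, List.sum_map_mul_left, mul_add]

/-- ★★ THE SAME in LEAD-20520 w3 g25's BRICK 2a `hT2` SHAPE (✓`…OrganTangentPullbackSquare.secondDiff_pullback_on`, windowed): base `P` FIRST, top `Q`
SECOND, majorant `sz n′ ≤ C·sz n`, base sizes `C·sz ≤ ρ`, grid `(Q.take l)·((P.take i)·Y)`: `|f (Q·(P·Y)) − f (P·Y) − f (Q·Y) + f Y| ≤ C·ΣΣ k·sz·sz`. [folklore] -/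
theorem secondDiff_path_path_of_push_on' (Good : X → Prop) (ρ : ℝ) (act : X → ι → M → X) (sz : M → ℝ) (f : X → ℝ)
    (k : ι → ι → ℝ) (φ : M → M → M) (Inv : M → M → Prop) (C : ℝ)
    (hH : ∀ (U : X) (b b' : ι) (m m' : M), Good U → Good (act U b m) → Good (act U b' m') → Good (act (act U b m) b' m') →
      sz m ≤ ρ → sz m' ≤ ρ → |f (act (act U b m) b' m') - f (act U b m) - f (act U b' m') + f U| ≤ k b b' * sz m * sz m')
    (hk : ∀ b b', 0 ≤ k b b') (hsz : ∀ m, 0 ≤ sz m)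
    (hpush : ∀ (U : X) (b : ι) (g h : M), act (act U b g) b h = act (act U b h) b (φ h g))
    (hcomm : ∀ (U : X) (b c : ι) (g h : M), b ≠ c → act (act U b g) c h = act (act U c h) b g)
    (hInv0 : ∀ n : M, Inv n n) (hInvφ : ∀ (n n' h : M), Inv n n' → Inv n (φ h n'))
    (hInvS : ∀ (n n' : M), Inv n n' → sz n' ≤ C * sz n) :
    ∀ (Y : X) (P Q : List (ι × M)),
      (∀ a ∈ P, C * sz a.2 ≤ ρ) → (∀ c ∈ Q, sz c.2 ≤ ρ) →
      (∀ i l, i ≤ P.length → l ≤ Q.length →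
        Good ((Q.take l).foldl (fun V p => act V p.1 p.2) ((P.take i).foldl (fun V p => act V p.1 p.2) Y))) →
      |f (Q.foldl (fun V p => act V p.1 p.2) (P.foldl (fun V p => act V p.1 p.2) Y)) - f (P.foldl (fun V p => act V p.1 p.2) Y)
          - f (Q.foldl (fun V p => act V p.1 p.2) Y) + f Y|
        ≤ C * (P.map (fun a => (Q.map (fun c => k a.1 c.1 * sz a.2 * sz c.2)).sum)).sum := by
  intro Y P Q hszP hszQ hgrid
  have h := secondDiff_path_path_of_push_on Good ρ act sz (fun m => C * sz m) f k φ Inv hH hk hsz hpush hcomm hInv0 hInvφ hInvS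
    Q hszQ P Y hszP (fun i hi j hj => hgrid j i hj hi)
  exact h.trans_eq (sum_sum_mul_const k sz C Q P)

/-! ## §1b The same telescope from a PATH-LEVEL conjugation hypothesis (LEAD-20520 w3 g25 WORD №4 shape) -/
/-- ★ ONE BASE MOVE UNDER A TOP PATH (windowed) from the PATH-LEVEL hypothesis `hconj` («pushing a base move under a whole top path conjugates it
ONCE, `sz ≤ C·sz`»), by reverse induction on `Q` (the new cell sits at `Q′·Y`): `≤ C·Σ_{(c,n) ∈ Q} k a c·sz m·sz n`. [folklore] -/
theorem secondDiff_move_path_of_conj_on (Good : X → Prop) (ρ : ℝ) (act : X → ι → M → X) (sz : M → ℝ) (f : X → ℝ)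
    (k : ι → ι → ℝ) (C : ℝ)
    (hH : ∀ (U : X) (b b' : ι) (m m' : M), Good U → Good (act U b m) → Good (act U b' m') → Good (act (act U b m) b' m') →
      sz m ≤ ρ → sz m' ≤ ρ → |f (act (act U b m) b' m') - f (act U b m) - f (act U b' m') + f U| ≤ k b b' * sz m * sz m')
    (hk : ∀ a c, 0 ≤ k a c) (hsz : ∀ n, 0 ≤ sz n)
    (hconj : ∀ (Y : X) (a : ι) (m : M) (Q : List (ι × M)), ∃ m' : M, sz m' ≤ C * sz m ∧
      Q.foldl (fun V p => act V p.1 p.2) (act Y a m) = act (Q.foldl (fun V p => act V p.1 p.2) Y) a m')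
    (Y : X) (a : ι) (m : M) (hm : C * sz m ≤ ρ) (Q : List (ι × M)) (hszQ : ∀ c ∈ Q, sz c.2 ≤ ρ)
    (hgood : ∀ l ≤ Q.length, Good ((Q.take l).foldl (fun V p => act V p.1 p.2) Y) ∧
      Good ((Q.take l).foldl (fun V p => act V p.1 p.2) (act Y a m))) :
    |f (Q.foldl (fun V p => act V p.1 p.2) (act Y a m)) - f (act Y a m) - f (Q.foldl (fun V p => act V p.1 p.2) Y) + f Y|
      ≤ C * (Q.map (fun c => k a c.1 * sz m * sz c.2)).sum := by
  induction Q using List.reverseRecOn with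
  | nil =>
    have h0 : f (act Y a m) - f (act Y a m) - f Y + f Y = 0 := by ring
    simp only [List.foldl_nil, List.map_nil, List.sum_nil, mul_zero, h0, abs_zero, le_refl]
  | append_singleton Q' s ih =>
    have hlen : Q'.length ≤ (Q' ++ [s]).length := by simp
    have hgood' : ∀ l ≤ Q'.length, Good ((Q'.take l).foldl (fun V p => act V p.1 p.2) Y) ∧
        Good ((Q'.take l).foldl (fun V p => act V p.1 p.2) (act Y a m)) := by
      intro l hl
      have := hgood l (hl.trans hlen)
      rwa [List.take_append_of_le_length hl] at this
    have h2 := ih (fun c hc => hszQ c (List.mem_append_left _ hc)) hgood'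
    obtain ⟨m', hm', hZ⟩ := hconj Y a m Q'
    have hQ'Y := hgood Q'.length hlen
    rw [List.take_left' rfl] at hQ'Y
    have hQY := hgood (Q' ++ [s]).length le_rfl
    rw [List.take_length] at hQY
    simp only [List.foldl_append, List.foldl_cons, List.foldl_nil] at hQY ⊢
    rw [hZ] at hQ'Y hQY h2 ⊢
    have h1 := hH (Q'.foldl (fun V p => act V p.1 p.2) Y) a s.1 m' s.2 hQ'Y.1 hQ'Y.2 hQY.1 hQY.2
      (hm'.trans hm) (hszQ s (List.mem_append_right _ (by simp)))
    have h1' : |f (act (act (Q'.foldl (fun V p => act V p.1 p.2) Y) a m') s.1 s.2) - f (act (Q'.foldl (fun V p => act V p.1 p.2) Y) a m')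
        - f (act (Q'.foldl (fun V p => act V p.1 p.2) Y) s.1 s.2) + f (Q'.foldl (fun V p => act V p.1 p.2) Y)|
        ≤ C * (k a s.1 * sz m * sz s.2) := by
      refine h1.trans ((mul_le_mul_of_nonneg_right (mul_le_mul_of_nonneg_left hm' (hk a s.1)) (hsz s.2)).trans_eq ?_)
      ring
    refine (abs_le_of_add_eq h1' h2 ?_).trans_eq ?_
    · ring
    · simp only [List.map_append, List.map_cons, List.map_nil, List.sum_append, List.sum_cons, List.sum_nil]; ring

/-- ★★ THE DOUBLE TELESCOPE FROM THE PATH-LEVEL HYPOTHESIS `hconj`, in BRICK 2a's `hT2` shape (windowed; base `P` first, top `Q` second). [folklore] -/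
theorem secondDiff_path_path_of_conj_on (Good : X → Prop) (ρ : ℝ) (act : X → ι → M → X) (sz : M → ℝ) (f : X → ℝ)
    (k : ι → ι → ℝ) (C : ℝ)
    (hH : ∀ (U : X) (b b' : ι) (m m' : M), Good U → Good (act U b m) → Good (act U b' m') → Good (act (act U b m) b' m') →
      sz m ≤ ρ → sz m' ≤ ρ → |f (act (act U b m) b' m') - f (act U b m) - f (act U b' m') + f U| ≤ k b b' * sz m * sz m')
    (hk : ∀ a c, 0 ≤ k a c) (hsz : ∀ n, 0 ≤ sz n)
    (hconj : ∀ (Y : X) (a : ι) (m : M) (Q : List (ι × M)), ∃ m' : M, sz m' ≤ C * sz m ∧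
      Q.foldl (fun V p => act V p.1 p.2) (act Y a m) = act (Q.foldl (fun V p => act V p.1 p.2) Y) a m') :
    ∀ (Y : X) (P Q : List (ι × M)),
      (∀ a ∈ P, C * sz a.2 ≤ ρ) → (∀ c ∈ Q, sz c.2 ≤ ρ) →
      (∀ i l, i ≤ P.length → l ≤ Q.length →
        Good ((Q.take l).foldl (fun V p => act V p.1 p.2) ((P.take i).foldl (fun V p => act V p.1 p.2) Y))) →
      |f (Q.foldl (fun V p => act V p.1 p.2) (P.foldl (fun V p => act V p.1 p.2) Y)) - f (P.foldl (fun V p => act V p.1 p.2) Y)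
          - f (Q.foldl (fun V p => act V p.1 p.2) Y) + f Y|
        ≤ C * (P.map (fun a => (Q.map (fun c => k a.1 c.1 * sz a.2 * sz c.2)).sum)).sum := by
  intro Y P
  induction P generalizing Y with
  | nil =>
    intro Q _ _ _
    have h0 : f (Q.foldl (fun V p => act V p.1 p.2) Y) - f Y - f (Q.foldl (fun V p => act V p.1 p.2) Y) + f Y = 0 := by ring
    simp only [List.foldl_nil, List.map_nil, List.sum_nil, mul_zero, h0, abs_zero, le_refl]
  | cons a as ih =>
    intro Q hszP hszQ hgrid
    have hgood0 : ∀ l ≤ Q.length, Good ((Q.take l).foldl (fun V p => act V p.1 p.2) Y) ∧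
        Good ((Q.take l).foldl (fun V p => act V p.1 p.2) (act Y a.1 a.2)) := by
      intro l hl
      refine ⟨?_, ?_⟩
      · have := hgrid 0 l (Nat.zero_le _) hl
        simpa [List.take_zero, List.foldl_nil] using this
      · have := hgrid 1 l (by simp) hl
        simpa [List.take_succ_cons, List.take_zero, List.foldl_cons, List.foldl_nil] using this
    have h1 := secondDiff_move_path_of_conj_on Good ρ act sz f k C hH hk hsz hconj Y a.1 a.2 (hszP a (by simp)) Q hszQ hgood0
    have hgrid' : ∀ i l, i ≤ as.length → l ≤ Q.length →
        Good ((Q.take l).foldl (fun V p => act V p.1 p.2) ((as.take i).foldl (fun V p => act V p.1 p.2) (act Y a.1 a.2))) := by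
      intro i l hi hl
      have := hgrid (i + 1) l (by simpa using hi) hl
      simpa [List.take_succ_cons, List.foldl_cons] using this
    have h2 := ih (act Y a.1 a.2) Q (fun a' ha' => hszP a' (List.mem_cons_of_mem a ha')) hszQ hgrid'
    rw [List.foldl_cons]
    refine (abs_le_of_add_eq h2 h1 ?_).trans_eq ?_
    · ring
    · simp only [List.map_cons, List.sum_cons]; ring

end Abstract

/-! ## §2 The organ's instance: right exponential one-bond moves of `SU(2)` gauge fields, shared bonds -/
section Organ

variable {P : Params} {j : ℕ} [DecidableEq (PBond P j)]

/-- SAME-BOND PUSH: `U_b·e^{g}·e^{h} = U_b·e^{h}·e^{Ad_{e^{−h}} g}` (✓`conj_expPt`). [cite: Balaban1989LargeFieldI, (1.77) p.194] -/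
theorem move_push_same (U : GaugeField P j (Matrix.specialUnitaryGroup (Fin 2) ℂ)) (b : PBond P j) (g h : Fin 3 → ℝ) :
    update (update U b (U b * expPt g)) b ((update U b (U b * expPt g)) b * expPt h)
      = update (update U b (U b * expPt h)) b
          ((update U b (U b * expPt h)) b * expPt (WithLp.ofLp (adSU2 (expPt h)⁻¹ (toE g)))) := by
  rw [update_self, update_self, update_idem, update_idem, ← conj_expPt, inv_inv]
  congr 1
  group

/-- The invariant class of `n` (same `‖toE ·‖`) is preserved by every adjoint rotation (✓`norm_toE_adVec`). [folklore] -/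
theorem norm_toE_adVec_eq_of_eq {n n' : Fin 3 → ℝ} (h : Fin 3 → ℝ) (hn : ‖toE n'‖ = ‖toE n‖) :
    ‖toE (WithLp.ofLp (adSU2 (expPt h)⁻¹ (toE n')))‖ = ‖toE n‖ := by
  rw [norm_toE_adVec, hn]

/-- Sup-size of a parameter in the invariant class of `n`: `‖n′‖∕θ ≤ √3·‖n‖∕θ`. [folklore] -/
theorem div_le_sqrt3_div_of_norm_toE_eq {θ : ℝ} (hθ : 0 < θ) {n n' : Fin 3 → ℝ} (hn : ‖toE n'‖ = ‖toE n‖) :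
    ‖n'‖ / θ ≤ Real.sqrt 3 * ‖n‖ / θ := by
  apply div_le_div_of_nonneg_right _ hθ.le
  calc ‖n'‖ = ‖WithLp.ofLp (toE n')‖ := rfl
    _ ≤ ‖toE n'‖ := norm_ofLp_le _
    _ = ‖toE n‖ := hn
    _ ≤ Real.sqrt 3 * ‖n‖ := norm_toE_le n

/-- ★ PUSH ALONG A WINDOW PATH (organ): `(c, n)` under `p` = a move at `c` on top of `p·U` with a parameter of the same Euclidean chart norm
(`= Ad_{P_c⁻¹} n`, `P_c` the ordered product of `p`'s factors at `c`; hence same `dist1`, sup-size `≤ √3‖n‖`). [folklore] -/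
theorem exists_push_window_path (c : PBond P j) (n : Fin 3 → ℝ) (p : List (PBond P j × (Fin 3 → ℝ)))
    (U : GaugeField P j (Matrix.specialUnitaryGroup (Fin 2) ℂ)) :
    ∃ n'' : Fin 3 → ℝ, ‖toE n''‖ = ‖toE n‖ ∧
      p.foldl (fun U s => update U s.1 (U s.1 * expPt s.2)) (update U c (U c * expPt n))
        = update (p.foldl (fun U s => update U s.1 (U s.1 * expPt s.2)) U) c
            ((p.foldl (fun U s => update U s.1 (U s.1 * expPt s.2)) U) c * expPt n'') :=
  exists_push
    (fun (U : GaugeField P j (Matrix.specialUnitaryGroup (Fin 2) ℂ)) (b : PBond P j) (v : Fin 3 → ℝ) => update U b (U b * expPt v))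
    (fun h g => WithLp.ofLp (adSU2 (expPt h)⁻¹ (toE g))) (fun n n' => ‖toE n'‖ = ‖toE n‖)
    (fun U b g h => move_push_same U b g h) (fun U _ _ g h hbc => move_comm_of_ne hbc g h U)
    (fun _ _ h hn => norm_toE_adVec_eq_of_eq h hn) c n p U n rfl

/-- ★★ **THE MIXED DIFFERENCE ALONG TWO ARBITRARY WINDOW PATHS** (shared bonds allowed): `HClauseSq` TEXT `h` VERBATIM (hypothesis), `0 ≤ k`, top
`p` (`‖v‖∕θ ≤ r`), base `q` (`√3·‖w‖∕θ ≤ r`), grid `θ`-small: `|R (p·(q·U)) − R (q·U) − R (p·U) + R U| ≤ Σ_{(c,w) ∈ q} Σ_{(a,v) ∈ p} k c a·(√3‖w‖∕θ)·(‖v‖∕θ)`. [folklore] -/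
theorem secondDiff_window_paths {θ r : ℝ} (hθ : 0 < θ) {k : PBond P j → PBond P j → ℝ} (hk : ∀ b b', 0 ≤ k b b')
    {R : GaugeField P j (Matrix.specialUnitaryGroup (Fin 2) ℂ) → ℝ}
    (h : ∀ (b b' : PBond P j) (v v' : Fin 3 → ℝ) (U V W Z : GaugeField P j (Matrix.specialUnitaryGroup (Fin 2) ℂ)),
      ‖v‖ ≤ r * θ → ‖v'‖ ≤ r * θ → PlaqSmall θ U → PlaqSmall θ V → PlaqSmall θ W → PlaqSmall θ Z →
      (∀ e, e ≠ b → V e = U e) → V b = U b * expPt v → (∀ e, e ≠ b' → W e = U e) → W b' = U b' * expPt v' →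
      (∀ e, e ≠ b' → Z e = V e) → Z b' = V b' * expPt v' →
      |R Z - R V - R W + R U| ≤ k b b' * (‖v‖ / θ) * (‖v'‖ / θ))
    (p q : List (PBond P j × (Fin 3 → ℝ))) (U : GaugeField P j (Matrix.specialUnitaryGroup (Fin 2) ℂ))
    (hszp : ∀ s ∈ p, ‖s.2‖ / θ ≤ r) (hszq : ∀ t ∈ q, Real.sqrt 3 * ‖t.2‖ / θ ≤ r)
    (hgood : ∀ i ≤ p.length, ∀ n ≤ q.length,
      PlaqSmall θ ((p.take i).foldl (fun U s => update U s.1 (U s.1 * expPt s.2))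
        ((q.take n).foldl (fun U s => update U s.1 (U s.1 * expPt s.2)) U))) :
    |R (p.foldl (fun U s => update U s.1 (U s.1 * expPt s.2)) (q.foldl (fun U s => update U s.1 (U s.1 * expPt s.2)) U)) -
      R (q.foldl (fun U s => update U s.1 (U s.1 * expPt s.2)) U) -
      R (p.foldl (fun U s => update U s.1 (U s.1 * expPt s.2)) U) + R U|
      ≤ (q.map (fun t => (p.map (fun s => k t.1 s.1 * (Real.sqrt 3 * ‖t.2‖ / θ) * (‖s.2‖ / θ))).sum)).sum :=
  secondDiff_path_path_of_push_on (PlaqSmall θ) r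
    (fun (U : GaugeField P j (Matrix.specialUnitaryGroup (Fin 2) ℂ)) (b : PBond P j) (v : Fin 3 → ℝ) => update U b (U b * expPt v))
    (fun w : Fin 3 → ℝ => ‖w‖ / θ) (fun w : Fin 3 → ℝ => Real.sqrt 3 * ‖w‖ / θ) R k
    (fun h g => WithLp.ofLp (adSU2 (expPt h)⁻¹ (toE g))) (fun n n' => ‖toE n'‖ = ‖toE n‖)
    (clause_update_of_HClauseSq hθ h) hk (fun w => div_nonneg (norm_nonneg w) hθ.le)
    (fun U b g h => move_push_same U b g h) (fun U _ _ g h hbc => move_comm_of_ne hbc g h U)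
    (fun _ => rfl) (fun _ _ h hn => norm_toE_adVec_eq_of_eq h hn) (fun _ _ hn => div_le_sqrt3_div_of_norm_toE_eq hθ hn)
    p hszp q U hszq hgood

/-- ★★ **THE SAME IN BRICK 2a's `hT2` SHAPE** (`C := √3`; base `Pb` first with `√3·(‖w‖∕θ) ≤ r`, top `Qt` second, grid `(Qt.take l)·((Pb.take i)·Y)`):
discharges ✓`…OrganTangentPullbackSquare.secondDiff_pullback_on`'s `hT2` by `exact` at `act := update-move, sz := ‖·‖∕θ, Good := PlaqSmall θ, ρ := r`. [folklore] -/
theorem secondDiff_window_paths' {θ r : ℝ} (hθ : 0 < θ) {k : PBond P j → PBond P j → ℝ} (hk : ∀ b b', 0 ≤ k b b')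
    {R : GaugeField P j (Matrix.specialUnitaryGroup (Fin 2) ℂ) → ℝ}
    (h : ∀ (b b' : PBond P j) (v v' : Fin 3 → ℝ) (U V W Z : GaugeField P j (Matrix.specialUnitaryGroup (Fin 2) ℂ)),
      ‖v‖ ≤ r * θ → ‖v'‖ ≤ r * θ → PlaqSmall θ U → PlaqSmall θ V → PlaqSmall θ W → PlaqSmall θ Z →
      (∀ e, e ≠ b → V e = U e) → V b = U b * expPt v → (∀ e, e ≠ b' → W e = U e) → W b' = U b' * expPt v' →
      (∀ e, e ≠ b' → Z e = V e) → Z b' = V b' * expPt v' →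
      |R Z - R V - R W + R U| ≤ k b b' * (‖v‖ / θ) * (‖v'‖ / θ)) :
    ∀ (Y : GaugeField P j (Matrix.specialUnitaryGroup (Fin 2) ℂ)) (Pb Qt : List (PBond P j × (Fin 3 → ℝ))),
      (∀ a ∈ Pb, Real.sqrt 3 * (‖a.2‖ / θ) ≤ r) → (∀ c ∈ Qt, ‖c.2‖ / θ ≤ r) →
      (∀ i l, i ≤ Pb.length → l ≤ Qt.length →
        PlaqSmall θ ((Qt.take l).foldl (fun V p => update V p.1 (V p.1 * expPt p.2))
          ((Pb.take i).foldl (fun V p => update V p.1 (V p.1 * expPt p.2)) Y))) →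
      |R (Qt.foldl (fun V p => update V p.1 (V p.1 * expPt p.2)) (Pb.foldl (fun V p => update V p.1 (V p.1 * expPt p.2)) Y)) -
          R (Pb.foldl (fun V p => update V p.1 (V p.1 * expPt p.2)) Y) -
          R (Qt.foldl (fun V p => update V p.1 (V p.1 * expPt p.2)) Y) + R Y|
        ≤ Real.sqrt 3 * (Pb.map (fun a => (Qt.map (fun c => k a.1 c.1 * (‖a.2‖ / θ) * (‖c.2‖ / θ))).sum)).sum :=
  secondDiff_path_path_of_push_on' (PlaqSmall θ) r
    (fun (U : GaugeField P j (Matrix.specialUnitaryGroup (Fin 2) ℂ)) (b : PBond P j) (v : Fin 3 → ℝ) => update U b (U b * expPt v))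
    (fun w : Fin 3 → ℝ => ‖w‖ / θ) R k
    (fun h g => WithLp.ofLp (adSU2 (expPt h)⁻¹ (toE g))) (fun n n' => ‖toE n'‖ = ‖toE n‖) (Real.sqrt 3)
    (clause_update_of_HClauseSq hθ h) hk (fun w => div_nonneg (norm_nonneg w) hθ.le)
    (fun U b g h => move_push_same U b g h) (fun U _ _ g h hbc => move_comm_of_ne hbc g h U)
    (fun _ => rfl) (fun _ _ h hn => norm_toE_adVec_eq_of_eq h hn)
    (fun _ _ hn => (div_le_sqrt3_div_of_norm_toE_eq hθ hn).trans_eq (mul_div_assoc _ _ _))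

end Organ

end Summit.QuantumFields.YangMills.Theorems.OrganTangentTelescopeWindowPathShared

end
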